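import Literature.NumberTheory.Sieve.AsymptoticSieveForPrimesLoglog
import Literature.NumberTheory.Sieve.AsymptoticSieveForPrimesCancellation
import HarnessLib

/-!
# Friedlander–Iwaniec's asymptotic sieve for primes: Theorem 1, discharged (canonical name)

Topic `Literature/NumberTheory/Sieve` (trunk T-SIEVE), companion ("Proofs") file of
`AsymptoticSieveForPrimes.lean`. Source: J. Friedlander, H. Iwaniec, *Asymptotic sieve for primes*,
Ann. of Math. 148 (1998) 1041–1065 [FriedlanderIwaniecASP1998] (= arXiv:math/9811186), Theorem 1
(1.17) together with the paragraph after it on p. 1044 ("In practice (B) can be established in the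
range (B1) for `δ = (log x)^α` and `Δ = x^η` … the error term in (1.17) becomes
`O(log log x / log x)` … for the proof we may assume that `x ≥ Δ(x)^A`, `Δ(x) ≥ δ(x)^A`, and
`δ(x) ≥ A`").

Status of the two vendored forms of Theorem 1 (`AsymptoticSieveForPrimes.lean`):
* the literal reading `Literature.NumberTheory.Sieve.fi_asymptotic_sieve_primes` (all parameter functions `δ, Δ ≥ 2`, no
  proviso `x ≥ Δ^A`) is FALSE: `Literature.NumberTheory.Sieve.fi_asymptotic_sieve_primes_false`
  (`AsymptoticSieveForPrimesCounterexample.lean`; witness `a_n = μ²(n)`, `D = x^{3/4}`,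
  `δ = 2√x`, `Δ = exp(x³)`);
* the corrected form `Literature.NumberTheory.Sieve.fi_asymptotic_sieve_primes_loglog` (FI's working regime
  `δ = (log x)^α`, `Δ = x^θ`, `0 < θ < 1/3`, error `O(log log x / log x)`) is a THEOREM of the tree:
  `fi_asymptotic_sieve_primes_loglog_of_cancellation` (`AsymptoticSieveForPrimesLoglog.lean`, the
  assembly of FI §§2–8 = the series `AsymptoticSieveForPrimes{Proofs, Inputs, Decomposition,
  DecompositionProofs, Reduction, BilinearStrong, Assembly, Brun, Tyz, T, S1, S2, S3Minus, S3Plus,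
  S3Assembly, AssemblyInputs, LogSums, LogSumIdentity}`) applied to the proved FI (2.4)
  `fi_moebius_density_cancellation_holds` (`AsymptoticSieveForPrimesCancellation.lean`).
This file only records that discharge under the canonical name
`fi_asymptotic_sieve_primes_loglog_holds`, and the unconditional corollary
`∑_{p ≤ x} a_p log p ∼ H A(x)`.

## Mathlib search

Nothing to search: a composition of theorems of this series (`lean search
'fi_asymptotic_sieve_primes_loglog_holds'`: no declaration before this file).
-/

noncomputable section

open Filter Asymptotics

namespace Literature.NumberTheory.Sieve

/-- **Friedlander–Iwaniec, asymptotic sieve for primes, Theorem 1 in the regime `δ = (log x)^α`,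
`Δ = x^θ` (`α > 0`, `0 < θ < 1/3`), DISCHARGED**: under (1.4), (1.6)–(1.9), (1.16), (R), (R1) and
(B) in the ranges (B1)–(B3) for these parameter functions (`SieveSequence.FIAsymptoticSieveHypotheses`)
and `A.HasDensityConstant H`,
`∑_{p ≤ x} a_p log p - H A(x) = O(H A(x) · log log x / log x)` (FI (1.17) with
`log δ / log Δ = (α/θ) log log x / log x`, p. 1044). One line from the tree:
`fi_asymptotic_sieve_primes_loglog_of_cancellation fi_moebius_density_cancellation_holds`.
[cite: FriedlanderIwaniecASP1998, Theorem 1 (1.17) and p. 1044] -/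
theorem fi_asymptotic_sieve_primes_loglog_holds : fi_asymptotic_sieve_primes_loglog :=
  fi_asymptotic_sieve_primes_loglog_of_cancellation fi_moebius_density_cancellation_holds

/-- **Corollary: `∑_{p ≤ x} a_p log p ∼ H A(x)`**, unconditionally, for a sequence satisfying the
hypotheses of Theorem 1 with `δ = (log x)^α`, `Δ = x^θ` (`α > 0`, `0 < θ < 1/3`): the relative error
`O(log log x / log x)` of (1.17) tends to `0`.
[cite: FriedlanderIwaniecASP1998, Theorem 1 (1.17) and p. 1044] -/
theorem SieveSequence.FIAsymptoticSieveHypotheses.isEquivalent_sum_primes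
    {A : SieveSequence} {D : ℝ → ℝ} {α θ H : ℝ}
    (hhyp : A.FIAsymptoticSieveHypotheses D (fun x => Real.log x ^ α) (fun x => x ^ θ))
    (hα : 0 < α) (hθ : 0 < θ) (hθ3 : θ < 1 / 3) (hH : A.HasDensityConstant H) :
    (fun x : ℝ => ∑ p ∈ Nat.primesLE ⌊x⌋₊, A.a p * Real.log p) ~[atTop]
      fun x : ℝ => H * A.size x :=
  isEquivalent_sum_primes_of_cancellation fi_moebius_density_cancellation_holds hα hθ hθ3 hhyp hH

end Literature.NumberTheory.Sieve
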